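import Literature.Computability.AlgebraicComplexity.ArithCircuitChain
import Literature.Computability.AlgebraicComplexity.CircuitGateSemantics
import Literature.Computability.AlgebraicComplexity.ArithCircuitProofs
import Literature.Computability.AlgebraicComplexity.CircuitDepth
import HarnessLib

/-!
# Route `DepthWindow` — binarisation of unbounded-fan-in circuits (wires bound fan-in-two gates)

Helper file of the route `Theses/DepthWindow.lean` (decomp-valiant workshop, lens 4, generation 2; authored by
the lens seat).  Generation 0 of the route stated the necessity `VH → PerHardLog3` modulo a typed hypothesis
`BinarisationBound : complexity C.eval ≤ 2 * C.edgeSize + 2`; this file PROVES the sharper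
`complexity_eval_le_two_mul_edgeSize : complexity P.eval ≤ 2 * P.edgeSize` for every unbounded-fan-in
`ArithCircuit P` over any commutative semiring, by the tree's dynamic-programming bound `complexity_chain_le`
(`ArithCircuitChain.lean`): one chain step per gate, the step polynomial of a gate of fan-in `m` being a weighted
sum / product of `m` variables-or-constants, of fan-in-two complexity `≤ 2m`.  Used by `DepthWindowDial.lean`
(`perHardAtDepth_of_vh`, `summit_iff_split`).  Unconditional, 0 sorry, no new definitions, closes no item.

References: [Burgisser2000TCS] §2 (straight-line programs vs. circuits, cost of unbounded fan-in).
-/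

-- layout Summits/ValiantsHypothesis/ValiantsHypothesis forces the duplicated namespace component
set_option linter.dupNamespace false

namespace Summit.ValiantsHypothesis.ValiantsHypothesis.Theorems.DepthWindow

open MvPolynomial Literature.Computability.AlgebraicComplexity ArithCircuit

noncomputable section

universe u v w

variable {k : Type u} [CommSemiring k] {σ : Type v} {τ : Type w}

/-- A weighted sum of `m` complexity-`0` polynomials costs `≤ 2m` fan-in-two operations.
[cite: Burgisser2000TCS, §2] -/
theorem complexity_wsum_le {ι : Type*} (l : List ι) (a : ι → k) (p : ι → MvPolynomial τ k)
    (hp : ∀ i, complexity (p i) = 0) :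
    complexity ((l.map fun i => a i • p i).sum) ≤ 2 * l.length := by
  induction l with
  | nil => simp only [List.map_nil, List.sum_nil, List.length_nil, mul_zero]; rw [← C_0, complexity_C_holds]
  | cons x l ih =>
    simp only [List.map_cons, List.sum_cons, List.length_cons]
    calc complexity (a x • p x + (l.map fun i => a i • p i).sum)
        ≤ complexity (a x • p x) + complexity ((l.map fun i => a i • p i).sum) + 1 :=
          complexity_add_le_holds _ _
      _ ≤ (complexity (p x) + 1) + 2 * l.length + 1 := by
          gcongr
          · exact complexity_smul_le_holds _ _
      _ = 2 * (l.length + 1) := by rw [hp]; ring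

/-- A product of `m` complexity-`0` polynomials costs `≤ m` fan-in-two operations.
[cite: Burgisser2000TCS, §2] -/
theorem complexity_lprod_le {ι : Type*} (l : List ι) (p : ι → MvPolynomial τ k)
    (hp : ∀ i, complexity (p i) = 0) :
    complexity ((l.map p).prod) ≤ l.length := by
  induction l with
  | nil => simp only [List.map_nil, List.prod_nil, List.length_nil]; rw [← C_1, complexity_C_holds]
  | cons x l ih =>
    simp only [List.map_cons, List.prod_cons, List.length_cons]
    calc complexity (p x * (l.map p).prod)
        ≤ complexity (p x) + complexity ((l.map p).prod) + 1 := complexity_mul_le_holds _ _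
      _ ≤ 0 + l.length + 1 := by rw [hp]; gcongr
      _ = l.length + 1 := by ring

/-- **Binarisation** (wires bound fan-in-two gates): every unbounded-fan-in circuit `P` yields a fan-in-two
circuit for the same polynomial with at most `2 · edgeSize P` gates, i.e. `L(P.eval) ≤ 2 · #wires(P)`.
Proof: the dynamic-programming bound `complexity_chain_le` with one step per gate; the step polynomial of
gate `t` (over the variables `σ ⊕ Fin T`, `T` = number of gates, `inr s` standing for the value of gate `s`)
is the gate's weighted sum / product of its operands, of complexity `≤ 2 · fanIn` (weighted sum: `m`
scalings and `m - 1` additions; product: `m - 1` multiplications). [cite: Burgisser2000TCS, §2] -/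
theorem complexity_eval_le_two_mul_edgeSize (P : ArithCircuit k σ) :
    complexity P.eval ≤ 2 * P.edgeSize := by
  classical
  obtain ⟨gs, out⟩ := P
  show complexity (out.eval (gateValues gs)) ≤ 2 * (gs.map Gate.fanIn).sum
  -- step polynomials of operands and gates
  let opP : Operand k σ → MvPolynomial (σ ⊕ Fin gs.length) k := fun u =>
    match u with
    | .var i => X (Sum.inl i)
    | .const c => C c
    | .gate j => if h : j < gs.length then X (Sum.inr ⟨j, h⟩) else 0
  let gP : Gate k σ → MvPolynomial (σ ⊕ Fin gs.length) k := fun g =>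
    match g with
    | .sum args => (args.map fun a => a.1 • opP a.2).sum
    | .prod args => (args.map opP).prod
  have h_op0 : ∀ u, complexity (opP u) = 0 := by
    intro u
    cases u with
    | var i => exact complexity_X_holds _
    | const c => exact complexity_C_holds _
    | gate j =>
      by_cases h : j < gs.length
      · simp only [opP, dif_pos h]; exact complexity_X_holds _
      · simp only [opP, dif_neg h]; rw [← C_0]; exact complexity_C_holds _
  have h_gP : ∀ g : Gate k σ, complexity (gP g) ≤ 2 * g.fanIn := by
    intro g
    cases g with
    | sum args =>
      have h := complexity_wsum_le args (fun a => a.1) (fun a => opP a.2) (fun a => h_op0 a.2)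
      simpa [gP, Gate.fanIn, Gate.args] using h
    | prod args =>
      have h := complexity_lprod_le args opP h_op0
      simp only [gP, Gate.fanIn, Gate.args]
      omega
  -- the chain: `f t` = value of gate `t`, `F t` = step polynomial of gate `t`
  let f : Fin gs.length → MvPolynomial σ k := fun t => (gateValues gs).getD t 0
  let env : Fin gs.length → (σ ⊕ Fin gs.length) → MvPolynomial σ k := fun t =>
    Sum.elim X (fun s : Fin gs.length => if s < t then f s else 0)
  have h_evop : ∀ (t : Fin gs.length) (u : Operand k σ),
      u.eval ((gateValues gs).take t) = aeval (env t) (opP u) := by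
    intro t u
    cases u with
    | var i => simp [Operand.eval, opP, env]
    | const c => simp [Operand.eval, opP, env]
    | gate j =>
      simp only [Operand.eval, opP]
      by_cases hj : j < gs.length
      · rw [dif_pos hj, aeval_X]
        show _ = Sum.elim X (fun s : Fin gs.length => if s < t then f s else 0) (Sum.inr ⟨j, hj⟩)
        rw [Sum.elim_inr]
        simp only [Fin.lt_def, f]
        rw [List.getD_eq_getElem?_getD, List.getElem?_take]
        split_ifs with h
        · rw [List.getD_eq_getElem?_getD]
        · rfl
      · rw [dif_neg hj, map_zero, List.getD_eq_getElem?_getD, List.getElem?_take]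
        have ht : ¬ j < (t : ℕ) := fun h => hj (h.trans t.2)
        rw [if_neg ht]; rfl
  have h_evg : ∀ (t : Fin gs.length) (g : Gate k σ),
      g.eval ((gateValues gs).take t) = aeval (env t) (gP g) := by
    intro t g
    cases g with
    | sum args =>
      simp only [Gate.eval, gP, map_list_sum, List.map_map]
      congr 1
      refine List.map_congr_left fun a _ => ?_
      simp only [Function.comp_apply, map_smul, h_evop t]
    | prod args =>
      simp only [Gate.eval, gP, map_list_prod, List.map_map]
      congr 1
      refine List.map_congr_left fun a _ => ?_
      simp only [Function.comp_apply, h_evop t]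
  let F : Fin gs.length → MvPolynomial (σ ⊕ Fin gs.length) k := fun t => gP (gs[t])
  have hF : ∀ t : Fin gs.length,
      f t = aeval (Sum.elim X (fun s : Fin gs.length => if s < t then f s else 0)) (F t) := by
    intro t
    have h := gateValues_getElem? gs t (gs[t]) (List.getElem?_eq_getElem t.2)
    show (gateValues gs).getD t 0 = aeval (env t) (gP (gs[t]))
    rw [List.getD_eq_getElem?_getD, h, Option.getD_some, gateValues_take_eq_take]
    exact h_evg t _
  have hsum : ∑ s : Fin gs.length, complexity (F s) ≤ 2 * (gs.map Gate.fanIn).sum := by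
    calc ∑ s : Fin gs.length, complexity (F s) ≤ ∑ s : Fin gs.length, 2 * (gs[s]).fanIn :=
          Finset.sum_le_sum fun s _ => h_gP _
      _ = 2 * ∑ s : Fin gs.length, (gs[s]).fanIn := by rw [Finset.mul_sum]
      _ = 2 * (gs.map Gate.fanIn).sum := by
          rw [← List.sum_ofFn]
          simp only [Fin.getElem_fin, List.ofFn_getElem_eq_map]
  cases out with
  | var i => simp only [Operand.eval]; rw [complexity_X_holds]; exact Nat.zero_le _
  | const c => simp only [Operand.eval]; rw [complexity_C_holds]; exact Nat.zero_le _
  | gate j =>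
    simp only [Operand.eval]
    by_cases hj : j < gs.length
    · exact (complexity_chain_le f F hF ⟨j, hj⟩).trans hsum
    · rw [List.getD_eq_getElem?_getD, List.getElem?_eq_none (by rw [gateValues_length]; omega)]
      show complexity (0 : MvPolynomial σ k) ≤ _
      rw [← C_0, complexity_C_holds]; exact Nat.zero_le _

/-- Generation 0's typed hypothesis `BinarisationBound n C : complexity C.eval ≤ 2 * C.edgeSize + 2` (there over
`ℂ`), now a theorem over any commutative semiring. [cite: Burgisser2000TCS, §2] -/
theorem binarisationBound (C : ArithCircuit k σ) :
    complexity C.eval ≤ 2 * C.edgeSize + 2 :=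
  (complexity_eval_le_two_mul_edgeSize C).trans (Nat.le_add_right _ _)

end

end Summit.ValiantsHypothesis.ValiantsHypothesis.Theorems.DepthWindow
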